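import Summits.Langlands.Langlands.Theses.DyadicOddResidue
import Summits.Langlands.Langlands.Theorems.SectorComplement.Negative.DyadicOddResidueSectorComplementPosition
import Summits.Langlands.Langlands.Theorems.DyadicOddResidueDyadicDihedralFMGlue

/-!
# EQUIVALENCE AUDIT — `DyadicOddResidue.SectorComplement` (stmt-Langlands-18745): position, one level over

Planner scratch (crux-strategist, suspect = equivalence). The payload witness
`Theorems.skinnerWilesDefectOne_sectorComplement_iff_of_target` concerns the HOMONYMOUS decl of route
`SkinnerWilesDefectOne`; the same two-line position holds for THIS decl and is recorded here, kernel-checked,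
together with the exact conditioning set of the equivalence `SectorComplement ↔ Langlands`:
the route target `OddRegularReciprocityQ`, equivalently its four Fontaine–Mazur cells
(K1 `DyadicEisensteinFM`, K2 split = `DihedralProModularityCore` + `ProModularClassicality` +
`DyadicDihedralPrintedCellsFM` through the PROVED glue `DyadicDihedralFMGlue_proof`, S1 `OddPrimesRegularFM`,
S2 `DyadicNonsolvableFM`) — every one of which is OPEN on the ledger (2026-08-17).
-/

set_option linter.dupNamespace false

namespace Summit.Langlands.Langlands.Cruxes.SectorComplement.EquivalenceAuditDyadicOddResidue

open Summit.Langlands.Langlands.Theses.DyadicOddResidue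
open Summit.Langlands.Langlands.Theorems

/-- S → C: the frame is implied by the summit (discard the sector hypothesis). -/
theorem dor_sectorComplement_of_langlands : _root_.Langlands → SectorComplement :=
  fun h _ ↦ h

/-- The witness's shape for THIS decl: under the route TARGET, `SectorComplement ↔ Langlands`. -/
theorem dor_sectorComplement_iff_of_target (hX : OddRegularReciprocityQ) :
    SectorComplement ↔ _root_.Langlands :=
  ⟨fun hC ↦ hC hX, fun h _ ↦ h⟩

/-- The target is inside the summit as typed (landed p144479, contrapositive form). -/
theorem dor_target_of_langlands (hL : _root_.Langlands) : OddRegularReciprocityQ :=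
  Classical.byContradiction fun hX ↦ dyadicOddResidue_not_langlands_of_not_target hX hL

/-- Bookkeeping identity: the junction is the EXACT complement of the target in the summit. -/
theorem dor_langlands_iff_target_and_sectorComplement :
    _root_.Langlands ↔ OddRegularReciprocityQ ∧ SectorComplement :=
  ⟨fun hL ↦ ⟨dor_target_of_langlands hL, fun _ ↦ hL⟩, fun h ↦ h.2 h.1⟩

/-- The target from its four cells with K2 through its (proved) glue: the conditioning set of the
equivalence below, spelled out. -/
theorem dor_target_of_cells (h₁ : DyadicEisensteinFM) (h₂a : DihedralProModularityCore)
    (h₂b : ProModularClassicality) (h₂c : DyadicDihedralPrintedCellsFM) (h₃ : OddPrimesRegularFM)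
    (h₄ : DyadicNonsolvableFM) : OddRegularReciprocityQ := by
  have h₂ : DyadicDihedralFM := DyadicDihedralFMGlue_proof h₂a h₂b h₂c
  intro ℓ _ ρ hirr hodd hunr hdR hcpt ι
  by_cases hℓ : ℓ = 2
  · by_cases hres : ρ.IsResiduallyAbsIrreducible
    · by_cases hsol : IsSolvable ρ.residualRep.range
      · exact h₂ ℓ hℓ ρ hres hsol hirr hodd hunr hdR hcpt ι
      · exact h₄ ℓ hℓ ρ hres hsol hirr hodd hunr hdR hcpt ι
    · exact h₁ ℓ hℓ ρ hres hirr hodd hunr hdR hcpt ι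
  · exact h₃ ℓ hℓ ρ hirr hodd hunr hdR hcpt ι

/-- Under the OTHER SIX content hypotheses of `closes` (all OPEN items), `SectorComplement ↔ Langlands`
(`→` is the route's sorry-free `closes` with the proved glue plugged in). -/
theorem dor_sectorComplement_iff_of_cells (h₁ : DyadicEisensteinFM) (h₂a : DihedralProModularityCore)
    (h₂b : ProModularClassicality) (h₂c : DyadicDihedralPrintedCellsFM) (h₃ : OddPrimesRegularFM)
    (h₄ : DyadicNonsolvableFM) : SectorComplement ↔ _root_.Langlands :=
  ⟨fun hC ↦ closes h₁ h₂a h₂b h₂c DyadicDihedralFMGlue_proof h₃ h₄ hC, fun h _ ↦ h⟩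

/-- The proved glue alone conditions NOTHING about the junction: with only `DyadicDihedralFMGlue` in
hand, `SectorComplement ↔ Langlands` is still exactly `OddRegularReciprocityQ → (… ↔ …)`, i.e. the
equivalence needs the open target. Recorded as the trivial observation that the glue is a theorem
(so adding it as a hypothesis changes no statement). -/
theorem dor_glue_holds : DyadicDihedralFMGlue := DyadicDihedralFMGlue_proof

end Summit.Langlands.Langlands.Cruxes.SectorComplement.EquivalenceAuditDyadicOddResidue
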